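import Mathlib
import HarnessLib
import Literature.MathematicalPhysics.StatisticalMechanics.MuGSC
import Literature.MathematicalPhysics.StatisticalMechanics.LennardJonesClusters
import Summits.AtomisticToContinuum.Crystallization.Theorems.OverbindingBudgetCubeBookkeeping
import Summits.AtomisticToContinuum.Crystallization.Theorems.OverbindingBudgetCubeChargeLaw
import Summits.AtomisticToContinuum.Crystallization.Theorems.OverbindingBudgetExcessInstability
import Summits.AtomisticToContinuum.Crystallization.Theorems.OverbindingBudgetBindingSignLaw
import Summits.AtomisticToContinuum.Crystallization.Theorems.OverbindingBudgetViolatorDensityFloor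

/-!
# OverbindingBudget — the WALL-TENSION LEVER and its trigger for the registered interface-law stub (helper, `--supports stmt-31280`)

Route `OverbindingBudget` (Crystallization), crux `RobustDefectLimitWindows` (stmt-AtomisticToContinuum-31280), registered skeleton line v7
«HostedDustCut» (sha 624a0fa0…) whose fourth stub `stub_sealedChargeLaw` is the INTERFACE LAW `SealedChargeLaw 24 48 10`: a uniformly discrete
texture of covering radius `< 9/10` that is MAT, thin-cored at radius 10 and carries `L`-dense `(t,−t)`-SEALED PAIRS of width `≤ 25` has site
charge `Σ_{Y∩Q}(φ_Y − 2e) > ηℓ³` on arbitrarily large cubes.  This file (decomp-a2c lens-4 «minimal counterexample / extremal reduction»,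
generations 15–16; landing ordered by the cell critic, CRITIC-LEDGER row 153 (3)) lands, complete (no placeholders) and over LANDED Theorems files only:

* §A  readable names for the registered clauses (`BarlowClose`, `MAT`, `CleanT`, `ThinCores`, `TouchT`, `Linked`, `SealedDense`) and the TARGET
  `SealedChargeLaw W₀ P₀ r₀` — at `(24, 48, 10)` it is LITERALLY the registered stub text (pin `sealedChargeLaw_numerals_iff`, `Iff.rfl`).
* §B  the LEVER `WallTension W P` (concordance #1 of the cell typed once — the shared grain-boundary-tension statement of lens-4
  `stub_sealedChargeLaw`, lens-5 `stub_volumeExcessCellular`, lens-2 P₂): for every coexistence level `e` (`E_N/N → e` and `e ≤ E_N/N`),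
  separation `δ > 0`, spacing `a ∈ [47/50, 1]`, margin `t > 0` and sealing radius `L` there are `κ > 0`, `σ ≥ 0` such that for EVERY
  `δ`-separated `Y ⊆ ℝ³` (finite or infinite; no covering radius, no μ-stability, no recurrence, no MAT, no thin cores), every centre `c`,
  radius `R ≥ 1` and CONVEX body `K` with `B̄(c,R/4) ⊆ K ⊆ B̄(c,R)`:  `L`-local sealing of `Y` on `K` ⟹ `(e + κ)·#(Y∩K) − σR² ≤ ½ΣΣ_{Y∩K} V`
  (a finite double sum).  `LocallySealed a t W P L Y K` := every site of `Y ∩ K` has within `L` two `t`-clean sites at distance `≤ W` NOT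
  linked by a contact path of `≤ P` steps through `(−t)`-loosened-clean sites.
* §C  kernels: K0a–d dial monotonicity (`wallTension_anti`: antitone in `W`, monotone in `P`); K1 `ballFloor_of_wallTension` (closed balls —
  the currency lens-5/lens-2 consume); K2a–c cube geometry (`cube_convex`, `B̄(ℓ/4) ⊆ Q_ℓ ⊆ B̄(ℓ)` about the centre); **K3a
  `cubeCharge_of_cubeFloor` — the GS-free TRANSFER LEMMA**: a uniformly discrete texture of covering radius `< 9/10` with a per-particle floor
  `(e+κ)·#(Y∩Q) − σℓ² ≤ ½ΣΣ_{Y∩Q} V` (`κ > 0`) on all coordinate cubes of side `≥ 1` has site charge `> (κ/16)ℓ³` on EVERY cube of every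
  large even side (chain, all landed: `stub_siteSumSplit` (CubeBookkeeping), `stub_crossTermSmall` (CubeChargeLaw, stmt-30251),
  `grid_lower_bound` (BindingSignLaw), `finite_inter_cube` (ExcessInstability)); K3b/K3 the lever feeds the transfer lemma; **K4
  `sealedChargeLaw_of_wallTension : WallTension (W₀+1) P₀ → SealedChargeLaw W₀ P₀ r₀`** for all dials (the MAT / ThinCores binders are unused:
  the door never needed the host side condition); K4′ numerals `WallTension 25 48 → SealedChargeLaw 24 48 10`.
* §E  pins: `sealedChargeLaw_numerals_iff` (target at `(24,48,10)` ↔ the registered stub text, `Iff.rfl`); **`stub_sealedChargeLaw_of_wallTension :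
  WallTension 25 48 → ‹registered stub_sealedChargeLaw text›`** — so ANY future proof `h : WallTension 25 48` closes the registered stub by the
  one-line Theorems file `theorem stub_sealedChargeLaw … := stub_sealedChargeLaw_of_wallTension h`; `wallTension_numerals_iff` (the lever fully
  expanded over Mathlib + Literature, the text a future registration / citation uses).

WHY THE LEVER SHOULD HOLD (mechanism; census numbers uncertified): a sealed pair certifies within `W + 1.02a·P/π` of itself a codimension-one
sheet of sites failing even the loosened Barlow test, or a hole / amorphous pocket of detour `> P` — never a coherent twin / stacking fault
(clean, not sealed: Σ3{111} control) and never an isolated dislocation (linked around); `L`-density gives sheet area `≳ R³/L` in `K`, each unit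
of area costing `≥ σ₀(a,t) > 0` relative to the host it separates (cell census I-B13a/b, kit j340909: all eight non-coherent symmetric tilt
walls built are sealed at `(1/200, 24, 48)`, `σ ∈ [0.081 (Σ11{113}), 0.267 (Σ5{210})]` per unit area, incl. the 5°/10° low-angle walls);
`e ≤ E_N/N` makes every sub-chunk's internal energy `≥ e·#`, so nothing in `K` pays a sheet back; convexity caps the body's own surface (`−σR²`).
KILL: a family of `(t,−t)`-sealing LJ interfaces whose tension per area tends to `0` (census asks I-B13c, I-WT15).  TAGS (cell doctrine):
`WallTension` XL · IDEA-NEEDED (positivity of incoherent-interface tension, no far field) · INSTRUMENTABLE (finite patches) · STRONGER-in-kind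
than the stub it triggers (honest: a pricing lever, not a cut — the registered stub stays the item of record, critic row 153 (2)).

Deps (tree only): `Theorems.OverbindingBudgetCubeBookkeeping` (`stub_siteSumSplit`), `…CubeChargeLaw` (`stub_crossTermSmall`),
`…ExcessInstability` (`finite_inter_cube`), `…BindingSignLaw` (`grid_lower_bound`), `…ViolatorDensityFloor` (`GT`); Literature `MuGSC`
(`UniformlyDiscrete`), `LennardJonesClusters` (`lennardJones`, `groundStateEnergy`).  No Theses file is imported directly (the landed deps carry
`Theses.OverbindingBudget` transitively, as they must: they prove its items).  No `instance`, no `notation`.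
-/

namespace Summit.AtomisticToContinuum.Crystallization.Theorems.OverbindingBudgetWallTensionLever

open scoped BigOperators
open Literature.MathematicalPhysics.StatisticalMechanics (UniformlyDiscrete lennardJones groundStateEnergy)
open Summit.AtomisticToContinuum.Crystallization.Theorems.OverbindingBudgetCubeBookkeeping (stub_siteSumSplit)
open Summit.AtomisticToContinuum.Crystallization.Theorems.OverbindingBudgetCubeChargeLaw (stub_crossTermSmall)
open Summit.AtomisticToContinuum.Crystallization.Theorems.OverbindingBudgetExcessInstability (finite_inter_cube)
open Summit.AtomisticToContinuum.Crystallization.Theorems.OverbindingBudgetBindingSignLaw (grid_lower_bound)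
open Summit.AtomisticToContinuum.Crystallization.Theorems.OverbindingBudgetViolatorDensityFloor (GT)

/-! ## §A Lineage predicates — VERBATIM the clauses of the registered line v7 «HostedDustCut» on stmt-31280 (`GT` is the tree's
`OverbindingBudgetViolatorDensityFloor.GT`; the others are readable names for verbatim sub-formulas of the registered stub texts, pinned in §E) -/


/-- 1/5-Barlow-closeness of the rescaled 1/50-shell (verbatim, gen 8). -/
def BarlowClose (a : ℝ) (Y : Set (EuclideanSpace ℝ (Fin 3))) (y : EuclideanSpace ℝ (Fin 3)) : Prop :=
  (∃ T : Finset (EuclideanSpace ℝ (Fin 3)), (↑T : Set (EuclideanSpace ℝ (Fin 3))) = (fun w => a⁻¹ • (w - y)) '' {w ∈ Y | w ≠ y ∧ dist y w ≤ a * (1 + 1 / 50)} ∧ (Literature.Geometry.DiscreteGeometry.ShellCloseTo (1 / 5) T Literature.Geometry.DiscreteGeometry.fccKissingPattern ∨ Literature.Geometry.DiscreteGeometry.ShellCloseTo (1 / 5) T Literature.Geometry.DiscreteGeometry.hcpKissingPattern))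

/-- MAT: every clean site is Barlow-close (verbatim, gen 8).  NOT a hypothesis of `WallTension` (§B): kept only to state the target. -/
def MAT (a : ℝ) (Y : Set (EuclideanSpace ℝ (Fin 3))) : Prop :=
  ∀ y ∈ Y, GT a Y y → BarlowClose a Y y

/-- `CleanT a t Y y`: t-robustly clean at spacing `a` (verbatim, gen 11); `t = −s < 0` is the LOOSENED test. -/
def CleanT (a t : ℝ) (Y : Set (EuclideanSpace ℝ (Fin 3))) (y : EuclideanSpace ℝ (Fin 3)) : Prop :=
  ({w ∈ Y | w ≠ y ∧ dist y w ≤ a * (1 + 1 / 50) - t}.ncard = 12 ∧ (∀ w ∈ Y, w ≠ y → a * (1 - 1 / 50) + t ≤ dist y w ∧ (dist y w ≤ a * (1 + 1 / 50) - t ∨ a * (63 / 50) + t ≤ dist y w)) ∧ (∃ T : Finset (EuclideanSpace ℝ (Fin 3)), (↑T : Set (EuclideanSpace ℝ (Fin 3))) = (fun w => a⁻¹ • (w - y)) '' {w ∈ Y | w ≠ y ∧ dist y w ≤ a * (1 + 1 / 50)} ∧ (Literature.Geometry.DiscreteGeometry.ShellCloseTo (1 / 5 - t) T Literature.Geometry.DiscreteGeometry.fccKissingPattern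 ∨ Literature.Geometry.DiscreteGeometry.ShellCloseTo (1 / 5 - t) T Literature.Geometry.DiscreteGeometry.hcpKissingPattern)))

/-- `ThinCores a r Y` (verbatim, gen 11).  NOT a hypothesis of `WallTension`: L-dense sealed pairs already make clean sites (L+W)-dense. -/
def ThinCores (a r : ℝ) (Y : Set (EuclideanSpace ℝ (Fin 3))) : Prop :=
  ∀ z : EuclideanSpace ℝ (Fin 3), ∃ y ∈ Y, GT a Y y ∧ BarlowClose a Y y ∧ dist z y ≤ r

/-- contact at spacing `a` with margin `s` (verbatim, gen 12). -/
def TouchT (a s : ℝ) (p q : EuclideanSpace ℝ (Fin 3)) : Prop :=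
  p ≠ q ∧ dist p q ≤ a * (1 + 1 / 50) - s

/-- LINKAGE: a contact path of ≤ `P` steps through `s`-clean sites (verbatim, gen 12). -/
def Linked (a s : ℝ) (P : ℕ) (Y : Set (EuclideanSpace ℝ (Fin 3))) (y y' : EuclideanSpace ℝ (Fin 3)) : Prop :=
  ∃ n : ℕ, n ≤ P ∧ ∃ z : ℕ → EuclideanSpace ℝ (Fin 3), z 0 = y ∧ z n = y' ∧
    (∀ i : ℕ, i ≤ n → z i ∈ Y ∧ CleanT a s Y (z i)) ∧ (∀ i : ℕ, i < n → TouchT a s (z i) (z (i + 1)))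

/-- `SealedDense a t W P Y`: (t, −t)-sealed pairs of width ≤ `W` within bounded distance of EVERY site (verbatim, gen 12). -/
def SealedDense (a t W : ℝ) (P : ℕ) (Y : Set (EuclideanSpace ℝ (Fin 3))) : Prop :=
  ∃ L : ℝ, ∀ p ∈ Y, ∃ y ∈ Y, ∃ y' ∈ Y, dist y p ≤ L ∧ CleanT a t Y y ∧ CleanT a t Y y' ∧ dist y y' ≤ W ∧ ¬ Linked a (-t) P Y y y'

/-- THE TARGET · `SealedChargeLaw W₀ P₀ r₀` (verbatim, gen 12) = registered stub `stub_sealedChargeLaw` of line v7 «HostedDustCut» at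
(W₀, P₀, r₀) = (24, 48, 10) (pin `sealedChargeLaw_numerals_iff`, §E).  UNTOUCHED by this node: it is DERIVED (K3), never re-cut. -/
def SealedChargeLaw (W₀ : ℝ) (P₀ : ℕ) (r₀ : ℝ) : Prop :=
  ∀ e : ℝ, Filter.Tendsto (fun N : ℕ => Literature.MathematicalPhysics.StatisticalMechanics.groundStateEnergy Literature.MathematicalPhysics.StatisticalMechanics.lennardJones 3 N / N) Filter.atTop (nhds e) → (∀ N : ℕ, 0 < N → e ≤ Literature.MathematicalPhysics.StatisticalMechanics.groundStateEnergy Literature.MathematicalPhysics.StatisticalMechanics.lennardJones 3 N / N) → ∀ Y : Set (EuclideanSpace ℝ (Fin 3)), UniformlyDiscrete Y → (∀ z : EuclideanSpace ℝ (Fin 3), ∃ w ∈ Y, dist z w < 9 / 10) → ∀ a : ℝ, 47 / 50 ≤ a → a ≤ 1 → ∀ t : ℝ, 0 < t → MAT a Y → ThinCores a r₀ Y → SealedDense a t (W₀ + 1) P₀ Y → (∃ η : ℝ, 0 < η ∧ ∀ ℓ₀ : ℝ, ∃ ℓ : ℝ, ∃ c : EuclideanSpace ℝ (Fin 3), ∃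 F : Finset (EuclideanSpace ℝ (Fin 3)), ℓ₀ ≤ ℓ ∧ (↑F : Set (EuclideanSpace ℝ (Fin 3))) = Y ∩ {z | ∀ i : Fin 3, c i ≤ z i ∧ z i < c i + ℓ} ∧ η * ℓ ^ 3 < ∑ y ∈ F, ((∑' w : ↥Y, Literature.MathematicalPhysics.StatisticalMechanics.lennardJones (dist y (w : EuclideanSpace ℝ (Fin 3)))) - 2 * e))

/-! ## §B The LEVER: local wall tension on convex bodies (x-free, GS-free, μGSC-free, recurrence-free, MAT-free, core-free) -/

/-- `LocallySealed a t W P L Y K`: every site of `Y` inside the body `K` has, within distance `L`, a (t, −t)-SEALED PAIR of `Y` of width ≤ `W`: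
two t-robustly clean Barlow sites `y, y'`, `dist y y' ≤ W`, NOT linked by any contact path of ≤ `P` steps through (−t)-loosened-clean sites of `Y`.
Cleanliness and linkage are judged in the WHOLE of `Y` (a finite-patch property of `Y ∩ B(p, L + W + (1.02a + t)·P + 1.3)`); the pair may lie
outside `K`.  `SealedDense a t W P Y` is `∃ L, LocallySealed a t W P L Y univ` pointwise (K1). -/
def LocallySealed (a t W : ℝ) (P : ℕ) (L : ℝ) (Y K : Set (EuclideanSpace ℝ (Fin 3))) : Prop :=
  ∀ p ∈ Y ∩ K, ∃ y ∈ Y, ∃ y' ∈ Y, dist y p ≤ L ∧ CleanT a t Y y ∧ CleanT a t Y y' ∧ dist y y' ≤ W ∧ ¬ Linked a (-t) P Y y y'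

/-- **THE LEVER · `WallTension W P`** (CONCORDANCE #1 typed once; shared GS-free core of lens-4 `stub_sealedChargeLaw`, lens-5
`stub_volumeExcessCellular`, lens-2 P₂ «GB door»).  For every coexistence level `e` (TEND ∧ LB: all that is ever used of `e` is `e ≤ e_host`),
separation `δ > 0`, spacing `a ∈ [47/50, 1]`, margin `t > 0` and sealing radius `L` there are a TENSION RATE `κ > 0` and a SURFACE CONSTANT
`σ ≥ 0` such that: for every `δ`-separated point set `Y ⊆ ℝ³` (finite or infinite — NO covering radius, NO μ-stability, NO recurrence, NO Barlow-
matrix side condition MAT, NO thin cores), every centre `c`, radius `R ≥ 1` and every CONVEX body `K` with `B̄(c, R/4) ⊆ K ⊆ B̄(c, R)`, if `Y` is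
`L`-locally sealed on `K` then the INTERNAL energy of the chunk `S = Y ∩ K` (a finite double sum — no `tsum`) obeys
`(e + κ)·#S − σ·R² ≤ ½ Σ_{y,w ∈ S} V(|y − w|)`: excess `κ` PER PARTICLE above the coexistence energy, up to a surface term.
MECHANISM (why it should be true): a sealed pair certifies, within `W + 1.02a·P/π` of itself, a codimension-one sheet of sites failing even the
LOOSENED Barlow test (incoherent grain boundary, intergranular film, damage sheet) or a hole / amorphous pocket of detour > P — never a coherent
twin or stacking fault (their sites are clean: Σ3{111} control σ = −1.3e-4, NOT sealed) and never an ISOLATED dislocation or a widely spaced array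
(linked around: the fcc edge-dipole cell is NOT sealed) — but low-angle tilt walls DO seal in LJ down to θ ≥ 5° (I-B13a: dissociated cores overlap)
and then carry Read–Shockley tension (0.097 @ 5.06°, 0.160 @ 10.1°); L-density of such sheets gives sheet area ≳ R³/L inside K, each unit of area
costing ≥ σ₀(a,t) > 0 relative to the host crystal it separates (census I-B13a/b, kit j340909: σ ∈ [0.081, 0.267] r₀⁻² on the EIGHT sealed tilt
walls built, min at Σ11{113}; coherent strained slabs priced by elastic coercivity ≥ c·(1/50)², TAG 71 (ii)(b)); LB makes every sub-chunk's
internal energy ≥ e·#, so nothing in K can pay the sheets back; convexity bounds the body's own surface by 4πR² (the −σR²).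
WHY IT MIGHT FAIL (kill criterion, census I-B13c / I-B14): a family of (t,−t)-sealing interfaces in LJ whose tension per area tends to 0 —
an energetically degenerate incoherent interface, or sealing sheets realisable at vanishing strain; either would also kill `stub_sealedChargeLaw`.
TAGS: XL · IDEA-NEEDED (positivity of incoherent-interface tension, no far field) · INSTRUMENTABLE (finite patches: per (a,t,L,δ,R) a finite-
dimensional variational inequality) · STRONGER-in-kind than the target (drops MAT, ThinCores, covering radius; every scale, every convex body)
— the price of being the ONE statement three lineages cite; its lens-4 consequence is exactly the registered stub (K3). -/
def WallTension (W : ℝ) (P : ℕ) : Prop :=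
  ∀ e : ℝ, Filter.Tendsto (fun N : ℕ => Literature.MathematicalPhysics.StatisticalMechanics.groundStateEnergy Literature.MathematicalPhysics.StatisticalMechanics.lennardJones 3 N / N) Filter.atTop (nhds e) → (∀ N : ℕ, 0 < N → e ≤ Literature.MathematicalPhysics.StatisticalMechanics.groundStateEnergy Literature.MathematicalPhysics.StatisticalMechanics.lennardJones 3 N / N) → ∀ δ : ℝ, 0 < δ → ∀ a : ℝ, 47 / 50 ≤ a → a ≤ 1 → ∀ t : ℝ, 0 < t → ∀ L : ℝ, ∃ κ : ℝ, 0 < κ ∧ ∃ σ : ℝ, 0 ≤ σ ∧ ∀ Y : Set (EuclideanSpace ℝ (Fin 3)), (∀ p ∈ Y, ∀ q ∈ Y, p ≠ q → δ ≤ dist p q) → ∀ c : EuclideanSpace ℝ (Fin 3), ∀ R : ℝ, 1 ≤ R → ∀ K : Set (EuclideanSpace ℝ (Fin 3)), Convex ℝ K → Metric.closedBall c (R / 4) ⊆ K → K ⊆ Metric.closedBall c R → LocallySealed a t W P L Y K → ∀ S : Finset (EuclideanSpace ℝ (Fin 3)), (↑S : Set (EuclideanSpace ℝ (Fin 3)))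 = Y ∩ K → (e + κ) * (S.card : ℝ) - σ * R ^ 2 ≤ 1 / 2 * ∑ y ∈ S, ∑ w ∈ S, Literature.MathematicalPhysics.StatisticalMechanics.lennardJones (dist y w)

/-! ## §C Kernels -/

/-- **K0a.** Linkage is monotone in the step budget (verbatim gen-12 kernel). -/
theorem linked_mono_steps {a s : ℝ} {P P' : ℕ} (h : P ≤ P') {Y : Set (EuclideanSpace ℝ (Fin 3))} {y y' : EuclideanSpace ℝ (Fin 3)}
    (hl : Linked a s P Y y y') : Linked a s P' Y y y' := by
  obtain ⟨n, hn, z, hz⟩ := hl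
  exact ⟨n, hn.trans h, z, hz⟩

/-- **K0b.** Local sealing is monotone in the width and antitone in the step budget. -/
theorem locallySealed_mono {a t W W' : ℝ} {P P' : ℕ} {L : ℝ} (hW : W ≤ W') (hP : P' ≤ P) {Y K : Set (EuclideanSpace ℝ (Fin 3))}
    (h : LocallySealed a t W P L Y K) : LocallySealed a t W' P' L Y K := by
  intro p hp
  obtain ⟨y, hy, y', hy', hd, hc, hc', hyy, hnl⟩ := h p hp
  exact ⟨y, hy, y', hy', hd, hc, hc', hyy.trans hW, fun hl => hnl (linked_mono_steps hP hl)⟩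

/-- **K0c.** Local sealing is monotone in the body. -/
theorem locallySealed_subset {a t W : ℝ} {P : ℕ} {L : ℝ} {Y K K' : Set (EuclideanSpace ℝ (Fin 3))} (hK : K ⊆ K')
    (h : LocallySealed a t W P L Y K') : LocallySealed a t W P L Y K :=
  fun p hp => h p ⟨hp.1, hK hp.2⟩

/-- **K0d (dial monotonicity).** `WallTension` is ANTITONE in the width and MONOTONE in the step budget: the lens-4 value (W, P) = (25, 48) is
implied by every (W', P') with W' ≥ 25, P' ≤ 48 — consumers with wider / shorter sealing conventions cite the same lemma. -/
theorem wallTension_anti {W W' : ℝ} {P P' : ℕ} (hW : W ≤ W') (hP : P' ≤ P) (h : WallTension W' P') : WallTension W P := by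
  intro e hT hLB δ hδ a ha1 ha2 t ht L
  obtain ⟨κ, hκ, σ, hσ, hf⟩ := h e hT hLB δ hδ a ha1 ha2 t ht L
  exact ⟨κ, hκ, σ, hσ, fun Y hY c R hR K hK h1 h2 hloc S hS => hf Y hY c R hR K hK h1 h2 (locallySealed_mono hW hP hloc) S hS⟩

/-- **K1 (lens-5 / lens-2 shape · ball chunks).** `WallTension` specialised to closed balls: the consumable form for `stub_volumeExcessCellular`
(ball-chunk internal energy ≥ e·#S + κ_D R³ − σ₁R², finite configurations `x N`: take `Y = Set.range (x N)`, δ = 7/10) once the consumer supplies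
ITS trigger «D-cellular at adjacency 23/20 ⟹ L(D)-locally sealed at lens-4's (a, t)» — a purely geometric statement this node does not assert. -/
theorem ballFloor_of_wallTension {W : ℝ} {P : ℕ} (hWT : WallTension W P) :
    ∀ e : ℝ, Filter.Tendsto (fun N : ℕ => Literature.MathematicalPhysics.StatisticalMechanics.groundStateEnergy Literature.MathematicalPhysics.StatisticalMechanics.lennardJones 3 N / N) Filter.atTop (nhds e) → (∀ N : ℕ, 0 < N → e ≤ Literature.MathematicalPhysics.StatisticalMechanics.groundStateEnergy Literature.MathematicalPhysics.StatisticalMechanics.lennardJones 3 N / N) → ∀ δ : ℝ, 0 < δ → ∀ a : ℝ, 47 / 50 ≤ a → a ≤ 1 → ∀ t : ℝ, 0 < t → ∀ L : ℝ, ∃ κ : ℝ, 0 < κ ∧ ∃ σ : ℝ, 0 ≤ σ ∧ ∀ Y : Set (EuclideanSpace ℝ (Fin 3)), (∀ p ∈ Y, ∀ q ∈ Y, p ≠ q → δ ≤ dist p q) → ∀ c : EuclideanSpace ℝ (Fin 3), ∀ R : ℝ, 1 ≤ R → LocallySealed a t W P L Y (Metric.closedBall c R) → ∀ S : Finset (EuclideanSpace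 ℝ (Fin 3)), (↑S : Set (EuclideanSpace ℝ (Fin 3))) = Y ∩ Metric.closedBall c R → (e + κ) * (S.card : ℝ) - σ * R ^ 2 ≤ 1 / 2 * ∑ y ∈ S, ∑ w ∈ S, Literature.MathematicalPhysics.StatisticalMechanics.lennardJones (dist y w) := by
  intro e hT hLB δ hδ a ha1 ha2 t ht L
  obtain ⟨κ, hκ, σ, hσ, h⟩ := hWT e hT hLB δ hδ a ha1 ha2 t ht L
  exact ⟨κ, hκ, σ, hσ, fun Y hY c R hR hloc S hS =>
    h Y hY c R hR _ (convex_closedBall c R) (Metric.closedBall_subset_closedBall (by linarith)) subset_rfl hloc S hS⟩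

/-- **K2a.** The half-open coordinate cube is convex. -/
theorem cube_convex (c : EuclideanSpace ℝ (Fin 3)) (ℓ : ℝ) :
    Convex ℝ {z : EuclideanSpace ℝ (Fin 3) | ∀ i : Fin 3, c i ≤ z i ∧ z i < c i + ℓ} := by
  intro x hx y hy a b ha hb hab i
  have hx' := hx i
  have hy' := hy i
  have e1 : (a • x + b • y) i = a * x i + b * y i := by simp
  rw [e1]
  have hab' : a * c i + b * c i = c i := by rw [← add_mul, hab, one_mul]
  refine ⟨by nlinarith [mul_le_mul_of_nonneg_left hx'.1 ha, mul_le_mul_of_nonneg_left hy'.1 hb], ?_⟩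
  rcases ha.eq_or_lt with rfl | ha0
  · have hb1 : b = 1 := by linarith
    subst hb1
    simpa using hy'.2
  · have h1 : a * x i < a * (c i + ℓ) := mul_lt_mul_of_pos_left hx'.2 ha0
    have h2 : b * y i ≤ b * (c i + ℓ) := mul_le_mul_of_nonneg_left hy'.2.le hb
    nlinarith [h1, h2, hab']

/-- **K2b.** The ball of radius ℓ/4 about the cube's centre lies in the half-open cube of side ℓ > 0. -/
theorem closedBall_subset_cube (c : EuclideanSpace ℝ (Fin 3)) {ℓ : ℝ} (hℓ : 0 < ℓ) :
    Metric.closedBall (c + WithLp.toLp 2 (fun _ : Fin 3 => ℓ / 2)) (ℓ / 4) ⊆ {z : EuclideanSpace ℝ (Fin 3) | ∀ i : Fin 3, c i ≤ z i ∧ z i < c i + ℓ} := by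
  intro z hz i
  rw [Metric.mem_closedBall] at hz
  have hi := (PiLp.dist_apply_le z (c + WithLp.toLp 2 (fun _ : Fin 3 => ℓ / 2)) i).trans hz
  have hc : (c + WithLp.toLp 2 (fun _ : Fin 3 => ℓ / 2)) i = c i + ℓ / 2 := by simp
  rw [hc, Real.dist_eq, abs_le] at hi
  constructor <;> linarith [hi.1, hi.2]

/-- **K2c.** The half-open cube of side ℓ ≥ 0 lies in the ball of radius ℓ about its centre (√3/2 ≤ 1). -/
theorem cube_subset_closedBall (c : EuclideanSpace ℝ (Fin 3)) {ℓ : ℝ} (hℓ : 0 ≤ ℓ) :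
    {z : EuclideanSpace ℝ (Fin 3) | ∀ i : Fin 3, c i ≤ z i ∧ z i < c i + ℓ} ⊆ Metric.closedBall (c + WithLp.toLp 2 (fun _ : Fin 3 => ℓ / 2)) ℓ := by
  intro z hz
  rw [Metric.mem_closedBall, EuclideanSpace.dist_eq]
  have hi : ∀ i : Fin 3, dist (z i) ((c + WithLp.toLp 2 (fun _ : Fin 3 => ℓ / 2)) i) ^ 2 ≤ (ℓ / 2) ^ 2 := by
    intro i
    have hc : (c + WithLp.toLp 2 (fun _ : Fin 3 => ℓ / 2)) i = c i + ℓ / 2 := by simp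
    rw [hc, Real.dist_eq]
    have h := hz i
    have habs : |z i - (c i + ℓ / 2)| ≤ ℓ / 2 := by
      rw [abs_le]; constructor <;> linarith [h.1, h.2]
    have h0 : 0 ≤ |z i - (c i + ℓ / 2)| := abs_nonneg _
    exact pow_le_pow_left₀ h0 habs 2
  calc √(∑ i, dist (z i) ((c + WithLp.toLp 2 (fun _ : Fin 3 => ℓ / 2)) i) ^ 2)
      ≤ √(∑ _i : Fin 3, (ℓ / 2) ^ 2) := Real.sqrt_le_sqrt (Finset.sum_le_sum (fun i _ => hi i))
    _ = √(3 * (ℓ / 2) ^ 2) := by simp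
    _ ≤ √(ℓ ^ 2) := Real.sqrt_le_sqrt (by nlinarith)
    _ = ℓ := Real.sqrt_sq hℓ

/-- **K3a (TRANSFER LEMMA · GS-free, lever-free bookkeeping, reusable by every cube-charge-shaped law of the lineage).**  If a uniformly
discrete texture of covering radius < 9/10 has a PER-PARTICLE EXCESS FLOOR on all coordinate cubes of side ≥ 1 — `(e + κ)·#(Y∩Q) − σ·ℓ² ≤ ½ΣΣ_{Y∩Q} V`
with `κ > 0` — then its SITE CHARGE `Σ_{Y∩Q}(φ_Y − 2e)` exceeds `(κ/16)·ℓ³` on EVERY cube of every large even side ℓ = 2n.  Chain (all LANDED):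
φ_Y = in-cube pair sum + cross field (`stub_siteSumSplit`); |cross| ≤ (κ/8)ℓ³ for ℓ ≥ ℓ₁ (`stub_crossTermSmall`, CubeChargeLaw stmt-30251);
# ≥ n³ = ℓ³/8 (`grid_lower_bound` on 2-cells: covering radius 9/10 < 1); ℓ > 32σ/κ.  This is the GS-free companion of the landed `cubeChargeLaw`
(μGSC ⟹ |charge| ≤ ηℓ³) and of `stub_excessInstability`: ANY local per-particle floor contradicts μ-stability — the door laws are exactly such floors. -/
theorem cubeCharge_of_cubeFloor {e : ℝ} {Y : Set (EuclideanSpace ℝ (Fin 3))} (hUD : UniformlyDiscrete Y)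
    (hsolid : ∀ z : EuclideanSpace ℝ (Fin 3), ∃ w ∈ Y, dist z w < 9 / 10) {κ σ : ℝ} (hκ : 0 < κ)
    (hfloorQ : ∀ c : EuclideanSpace ℝ (Fin 3), ∀ ℓ : ℝ, 1 ≤ ℓ → ∀ F : Finset (EuclideanSpace ℝ (Fin 3)),
      (↑F : Set (EuclideanSpace ℝ (Fin 3))) = Y ∩ {z | ∀ i : Fin 3, c i ≤ z i ∧ z i < c i + ℓ} →
      (e + κ) * (F.card : ℝ) - σ * ℓ ^ 2 ≤ 1 / 2 * ∑ y ∈ F, ∑ w ∈ F, Literature.MathematicalPhysics.StatisticalMechanics.lennardJones (dist y w)) :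
    ∃ n₀ : ℕ, ∀ n : ℕ, n₀ ≤ n → ∀ c : EuclideanSpace ℝ (Fin 3), ∀ F : Finset (EuclideanSpace ℝ (Fin 3)), (↑F : Set (EuclideanSpace ℝ (Fin 3))) = Y ∩ {z | ∀ i : Fin 3, c i ≤ z i ∧ z i < c i + (n : ℝ) * 2} → κ / 16 * ((n : ℝ) * 2) ^ 3 < ∑ y ∈ F, ((∑' w : ↥Y, Literature.MathematicalPhysics.StatisticalMechanics.lennardJones (dist y (w : EuclideanSpace ℝ (Fin 3)))) - 2 * e) := by
  classical
  obtain ⟨ℓ₁, hℓ₁⟩ := stub_crossTermSmall Y hUD (κ / 8) (by positivity)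
  obtain ⟨n₀, hn₀⟩ := exists_nat_ge (max ℓ₁ (32 * σ / κ + 1))
  refine ⟨max n₀ 1, ?_⟩
  intro n hn c F hF
  have hn1 : (1 : ℝ) ≤ n := by exact_mod_cast (le_max_right n₀ 1).trans hn
  have hnn : (n₀ : ℝ) ≤ n := by exact_mod_cast (le_max_left n₀ 1).trans hn
  set ℓ : ℝ := (n : ℝ) * 2 with hℓ
  have hℓpos : 0 < ℓ := by positivity
  have hℓ1 : ℓ₁ ≤ ℓ := by linarith [le_max_left ℓ₁ (32 * σ / κ + 1)]
  have hℓσ : 32 * σ / κ < ℓ := by linarith [le_max_right ℓ₁ (32 * σ / κ + 1)]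
  have hκℓ : 32 * σ < κ * ℓ := by
    rw [div_lt_iff₀ hκ] at hℓσ
    linarith
  have hFY : (↑F : Set (EuclideanSpace ℝ (Fin 3))) ⊆ Y := by
    rw [hF]; exact Set.inter_subset_left
  -- density from the covering radius: # ≥ n³
  have hheavy : ∀ z : EuclideanSpace ℝ (Fin 3), ∃ q ∈ Y, dist q z < 2 / 2 ∧ (1 : ℝ) ≤ (fun _ : EuclideanSpace ℝ (Fin 3) => (1 : ℝ)) q := by
    intro z
    obtain ⟨q, hq, hd⟩ := hsolid z
    refine ⟨q, hq, ?_, le_rfl⟩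
    rw [dist_comm]; linarith
  have hgrid := grid_lower_bound (fun _ : EuclideanSpace ℝ (Fin 3) => (1 : ℝ)) (fun _ _ => zero_le_one) two_pos hheavy n c F hF
  have hcard : (n : ℝ) ^ 3 ≤ (F.card : ℝ) := by simpa using hgrid
  -- the floor on the cube
  have hfl := hfloorQ c ℓ (by linarith) F hF
  -- bookkeeping
  have hsplit : ∀ y ∈ F, (∑' w : ↥Y, Literature.MathematicalPhysics.StatisticalMechanics.lennardJones (dist y (w : EuclideanSpace ℝ (Fin 3)))) =
      (∑ w ∈ F, Literature.MathematicalPhysics.StatisticalMechanics.lennardJones (dist y w)) +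
        ∑' w : ↥(Y \ ↑F), Literature.MathematicalPhysics.StatisticalMechanics.lennardJones (dist y (w : EuclideanSpace ℝ (Fin 3))) :=
    fun y _ => stub_siteSumSplit Y hUD F hFY y
  have hcross := (abs_le.mp (hℓ₁ ℓ c hℓ1 F hF)).1
  rw [Finset.sum_sub_distrib, Finset.sum_congr rfl hsplit, Finset.sum_add_distrib]
  simp only [Finset.sum_const, nsmul_eq_mul]
  have h8 : κ * ℓ ^ 3 = 8 * (κ * (n : ℝ) ^ 3) := by rw [hℓ]; ring
  have hκm : κ * ℓ ^ 3 ≤ 8 * (κ * (F.card : ℝ)) := by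
    rw [h8]; nlinarith [mul_le_mul_of_nonneg_left hcard hκ.le]
  have hσℓ : 32 * (σ * ℓ ^ 2) < κ * ℓ ^ 3 := by
    have h := mul_lt_mul_of_pos_right hκℓ (pow_pos hℓpos 2)
    nlinarith [h]
  nlinarith [hfl, hcross, hκm, hσℓ, hκ, hℓpos]

/-- **K3b (the lever feeds the transfer lemma).**  `WallTension W P` gives the per-particle floor on every coordinate cube of side ℓ ≥ 1 of a
uniformly discrete texture all of whose sites have a sealed pair within `L` (cube = convex body with B̄(ℓ/4) ⊆ Q ⊆ B̄(ℓ) about its centre, K2). -/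
theorem cubeFloor_of_wallTension {W : ℝ} {P : ℕ} (hWT : WallTension W P) :
    ∀ e : ℝ, Filter.Tendsto (fun N : ℕ => Literature.MathematicalPhysics.StatisticalMechanics.groundStateEnergy Literature.MathematicalPhysics.StatisticalMechanics.lennardJones 3 N / N) Filter.atTop (nhds e) → (∀ N : ℕ, 0 < N → e ≤ Literature.MathematicalPhysics.StatisticalMechanics.groundStateEnergy Literature.MathematicalPhysics.StatisticalMechanics.lennardJones 3 N / N) → ∀ δ : ℝ, 0 < δ → ∀ a : ℝ, 47 / 50 ≤ a → a ≤ 1 → ∀ t : ℝ, 0 < t → ∀ L : ℝ, ∃ κ : ℝ, 0 < κ ∧ ∃ σ : ℝ, 0 ≤ σ ∧ ∀ Y : Set (EuclideanSpace ℝ (Fin 3)), (∀ p ∈ Y, ∀ q ∈ Y, p ≠ q → δ ≤ dist p q) → (∀ p ∈ Y, ∃ y ∈ Y, ∃ y' ∈ Y, dist y p ≤ L ∧ CleanT a t Y y ∧ CleanT a t Y y' ∧ dist y y' ≤ W ∧ ¬ Linked a (-t) P Y y y') → ∀ c : EuclideanSpace ℝ (Fin 3), ∀ ℓ : ℝ,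 1 ≤ ℓ → ∀ F : Finset (EuclideanSpace ℝ (Fin 3)), (↑F : Set (EuclideanSpace ℝ (Fin 3))) = Y ∩ {z | ∀ i : Fin 3, c i ≤ z i ∧ z i < c i + ℓ} → (e + κ) * (F.card : ℝ) - σ * ℓ ^ 2 ≤ 1 / 2 * ∑ y ∈ F, ∑ w ∈ F, Literature.MathematicalPhysics.StatisticalMechanics.lennardJones (dist y w) := by
  intro e hT hLB δ hδ a ha1 ha2 t ht L
  obtain ⟨κ, hκ, σ, hσ, hfloor⟩ := hWT e hT hLB δ hδ a ha1 ha2 t ht L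
  refine ⟨κ, hκ, σ, hσ, fun Y hsep hL c ℓ hℓ F hF => ?_⟩
  have hℓpos : 0 < ℓ := by linarith
  exact hfloor Y hsep (c + WithLp.toLp 2 (fun _ : Fin 3 => ℓ / 2)) ℓ hℓ {z | ∀ i : Fin 3, c i ≤ z i ∧ z i < c i + ℓ}
    (cube_convex c ℓ) (by simpa using closedBall_subset_cube c hℓpos) (cube_subset_closedBall c hℓpos.le) (fun p hp => hL p hp.1) F hF

/-- **K3 (UNIFORM CUBE CHARGE — the lens-4 currency).**  `WallTension W P` ⟹ a uniformly discrete texture of covering radius < 9/10 whose sites all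
have a sealed pair within `L` carries site charge > (κ/16)·ℓ³ on EVERY coordinate cube of every large even side — strictly MORE than the target
asks (which wants one cube per scale). -/
theorem cubeCharge_of_wallTension {W : ℝ} {P : ℕ} (hWT : WallTension W P) :
    ∀ e : ℝ, Filter.Tendsto (fun N : ℕ => Literature.MathematicalPhysics.StatisticalMechanics.groundStateEnergy Literature.MathematicalPhysics.StatisticalMechanics.lennardJones 3 N / N) Filter.atTop (nhds e) → (∀ N : ℕ, 0 < N → e ≤ Literature.MathematicalPhysics.StatisticalMechanics.groundStateEnergy Literature.MathematicalPhysics.StatisticalMechanics.lennardJones 3 N / N) → ∀ Y : Set (EuclideanSpace ℝ (Fin 3)), UniformlyDiscrete Y → (∀ z : EuclideanSpace ℝ (Fin 3), ∃ w ∈ Y, dist z w < 9 / 10) → ∀ a : ℝ, 47 / 50 ≤ a → a ≤ 1 → ∀ t : ℝ, 0 < t → ∀ L : ℝ, (∀ p ∈ Y, ∃ y ∈ Y, ∃ y' ∈ Y, dist y p ≤ L ∧ CleanT a t Y y ∧ CleanT a t Y y' ∧ dist y y' ≤ W ∧ ¬ Linked a (-t) P Y y y') → ∃ η : ℝ, 0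 < η ∧ ∃ n₀ : ℕ, ∀ n : ℕ, n₀ ≤ n → ∀ c : EuclideanSpace ℝ (Fin 3), ∀ F : Finset (EuclideanSpace ℝ (Fin 3)), (↑F : Set (EuclideanSpace ℝ (Fin 3))) = Y ∩ {z | ∀ i : Fin 3, c i ≤ z i ∧ z i < c i + (n : ℝ) * 2} → η * ((n : ℝ) * 2) ^ 3 < ∑ y ∈ F, ((∑' w : ↥Y, Literature.MathematicalPhysics.StatisticalMechanics.lennardJones (dist y (w : EuclideanSpace ℝ (Fin 3)))) - 2 * e) := by
  intro e hT hLB Y hUD hsolid a ha1 ha2 t ht L hL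
  obtain ⟨δ, hδ, hsep⟩ := id hUD
  obtain ⟨κ, hκ, σ, -, hfloorQ⟩ := cubeFloor_of_wallTension hWT e hT hLB δ hδ a ha1 ha2 t ht L
  exact ⟨κ / 16, by positivity, cubeCharge_of_cubeFloor hUD hsolid hκ (hfloorQ Y hsep hL)⟩

/-- **K4 (THE TRIGGER).**  `WallTension (W₀+1) P₀ ⟹ SealedChargeLaw W₀ P₀ r₀` for every value of the dials: the registered door stub is the
lever's lens-4 consequence.  MAT and ThinCores are NOT used (underscore binders) — the lever is core-free; `r₀` is free. -/
theorem sealedChargeLaw_of_wallTension (W₀ r₀ : ℝ) (P₀ : ℕ) (hWT : WallTension (W₀ + 1) P₀) : SealedChargeLaw W₀ P₀ r₀ := by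
  intro e hT hLB Y hUD hsolid a ha1 ha2 t ht _hMAT _hThin hSD
  classical
  obtain ⟨L, hL⟩ := hSD
  obtain ⟨η, hη, n₀, hbig⟩ := cubeCharge_of_wallTension hWT e hT hLB Y hUD hsolid a ha1 ha2 t ht L hL
  refine ⟨η, hη, fun ℓ₀ => ?_⟩
  obtain ⟨n, hn⟩ := exists_nat_ge (max ℓ₀ (n₀ : ℝ))
  have hnn₀ : n₀ ≤ n := by exact_mod_cast (le_max_right ℓ₀ (n₀ : ℝ)).trans hn
  have hn0 : (0 : ℝ) ≤ n := Nat.cast_nonneg n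
  have hfin := finite_inter_cube hUD (0 : EuclideanSpace ℝ (Fin 3)) (by positivity : (0 : ℝ) ≤ (n : ℝ) * 2)
  refine ⟨(n : ℝ) * 2, 0, hfin.toFinset, by linarith [le_max_left ℓ₀ (n₀ : ℝ)], hfin.coe_toFinset, ?_⟩
  exact hbig n hnn₀ 0 hfin.toFinset hfin.coe_toFinset

/-- **K4′ (numerals).** At the line-v7 dials: `WallTension 25 48 ⟹ SealedChargeLaw 24 48 10`. -/
theorem sealedChargeLaw_numerals_of_wallTension (h : WallTension 25 48) : SealedChargeLaw 24 48 10 := by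
  have h' : WallTension (24 + 1) 48 := by norm_num; exact h
  exact sealedChargeLaw_of_wallTension 24 10 48 h'

/-! ## §E Pins (`Iff.rfl`) — the readable predicates ARE the registered texts -/

/-- PIN · the target at the v7 dials is, literally, the registered stub `stub_sealedChargeLaw` of line «HostedDustCut»
(`decomp-a2c-lens-4/g14/bc/line-hosteddust-v7.lean`, skeleton 624a0fa0…): a prover closes that stub by
`sealedChargeLaw_numerals_iff.1 (sealedChargeLaw_numerals_of_wallTension h)`. -/
theorem sealedChargeLaw_numerals_iff : SealedChargeLaw 24 48 10 ↔ (∀ e : ℝ, Filter.Tendsto (fun N : ℕ => Literature.MathematicalPhysics.StatisticalMechanics.groundStateEnergy Literature.MathematicalPhysics.StatisticalMechanics.lennardJones 3 N / N) Filter.atTop (nhds e) → (∀ N : ℕ, 0 < N → e ≤ Literature.MathematicalPhysics.StatisticalMechanics.groundStateEnergy Literature.MathematicalPhysics.StatisticalMechanics.lennardJones 3 N / N) → ∀ Y : Set (EuclideanSpace ℝ (Fin 3)), Literature.MathematicalPhysics.StatisticalMechanics.UniformlyDiscrete Y → (∀ z : EuclideanSpace ℝ (Fin 3), ∃ w ∈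 Y, dist z w < 9 / 10) → ∀ a : ℝ, 47 / 50 ≤ a → a ≤ 1 → ∀ t : ℝ, 0 < t → (∀ y ∈ Y, ({w ∈ Y | w ≠ y ∧ dist y w ≤ a * (1 + 1 / 50)}.ncard = 12 ∧ ∀ w ∈ Y, w ≠ y → a * (1 - 1 / 50) ≤ dist y w ∧ (dist y w ≤ a * (1 + 1 / 50) ∨ a * (63 / 50) ≤ dist y w)) → (∃ T : Finset (EuclideanSpace ℝ (Fin 3)), (↑T : Set (EuclideanSpace ℝ (Fin 3))) = (fun w => a⁻¹ • (w - y)) '' {w ∈ Y | w ≠ y ∧ dist y w ≤ a * (1 + 1 / 50)} ∧ (Literature.Geometry.DiscreteGeometry.ShellCloseTo (1 / 5) T Literature.Geometry.DiscreteGeometry.fccKissingPattern ∨ Literature.Geometry.DiscreteGeometry.ShellCloseTo (1 / 5) T Literature.Geometry.DiscreteGeometry.hcpKissingPattern))) → (∀ z : EuclideanSpace ℝ (Fin 3), ∃ y ∈ Y, ({w ∈ Y | w ≠ y ∧ dist y w ≤ a * (1 + 1 / 50)}.ncard = 12 ∧ ∀ w ∈ Y, w ≠ y → a * (1 - 1 /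 50) ≤ dist y w ∧ (dist y w ≤ a * (1 + 1 / 50) ∨ a * (63 / 50) ≤ dist y w)) ∧ (∃ T : Finset (EuclideanSpace ℝ (Fin 3)), (↑T : Set (EuclideanSpace ℝ (Fin 3))) = (fun w => a⁻¹ • (w - y)) '' {w ∈ Y | w ≠ y ∧ dist y w ≤ a * (1 + 1 / 50)} ∧ (Literature.Geometry.DiscreteGeometry.ShellCloseTo (1 / 5) T Literature.Geometry.DiscreteGeometry.fccKissingPattern ∨ Literature.Geometry.DiscreteGeometry.ShellCloseTo (1 / 5) T Literature.Geometry.DiscreteGeometry.hcpKissingPattern)) ∧ dist z y ≤ 10) → (∃ L : ℝ, ∀ p ∈ Y, ∃ y ∈ Y, ∃ y' ∈ Y, dist y p ≤ L ∧ ({w ∈ Y | w ≠ y ∧ dist y w ≤ a * (1 + 1 / 50) - t}.ncard = 12 ∧ (∀ w ∈ Y, w ≠ y → a * (1 - 1 / 50) + t ≤ dist y w ∧ (dist y w ≤ a * (1 + 1 / 50) - t ∨ a * (63 / 50) + t ≤ dist y w)) ∧ (∃ T : Finset (EuclideanSpace ℝ (Fin 3)), (↑T : Set (EuclideanSpace ℝ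 (Fin 3))) = (fun w => a⁻¹ • (w - y)) '' {w ∈ Y | w ≠ y ∧ dist y w ≤ a * (1 + 1 / 50)} ∧ (Literature.Geometry.DiscreteGeometry.ShellCloseTo (1 / 5 - t) T Literature.Geometry.DiscreteGeometry.fccKissingPattern ∨ Literature.Geometry.DiscreteGeometry.ShellCloseTo (1 / 5 - t) T Literature.Geometry.DiscreteGeometry.hcpKissingPattern))) ∧ ({w ∈ Y | w ≠ y' ∧ dist y' w ≤ a * (1 + 1 / 50) - t}.ncard = 12 ∧ (∀ w ∈ Y, w ≠ y' → a * (1 - 1 / 50) + t ≤ dist y' w ∧ (dist y' w ≤ a * (1 + 1 / 50) - t ∨ a * (63 / 50) + t ≤ dist y' w)) ∧ (∃ T : Finset (EuclideanSpace ℝ (Fin 3)), (↑T : Set (EuclideanSpace ℝ (Fin 3))) = (fun w => a⁻¹ • (w - y')) '' {w ∈ Y | w ≠ y' ∧ dist y' w ≤ a * (1 + 1 / 50)} ∧ (Literature.Geometry.DiscreteGeometry.ShellCloseTo (1 / 5 - t) T Literature.Geometry.DiscreteGeometry.fccKissingPattern ∨ Literature.Geometry.DiscreteGeometry.ShellCloseTo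 (1 / 5 - t) T Literature.Geometry.DiscreteGeometry.hcpKissingPattern))) ∧ dist y y' ≤ 24 + 1 ∧ ¬ (∃ n : ℕ, n ≤ 48 ∧ ∃ z : ℕ → EuclideanSpace ℝ (Fin 3), z 0 = y ∧ z n = y' ∧ (∀ i : ℕ, i ≤ n → z i ∈ Y ∧ ({w ∈ Y | w ≠ (z i) ∧ dist (z i) w ≤ a * (1 + 1 / 50) - (-t)}.ncard = 12 ∧ (∀ w ∈ Y, w ≠ (z i) → a * (1 - 1 / 50) + (-t) ≤ dist (z i) w ∧ (dist (z i) w ≤ a * (1 + 1 / 50) - (-t) ∨ a * (63 / 50) + (-t) ≤ dist (z i) w)) ∧ (∃ T : Finset (EuclideanSpace ℝ (Fin 3)), (↑T : Set (EuclideanSpace ℝ (Fin 3))) = (fun w => a⁻¹ • (w - (z i))) '' {w ∈ Y | w ≠ (z i) ∧ dist (z i) w ≤ a * (1 + 1 / 50)} ∧ (Literature.Geometry.DiscreteGeometry.ShellCloseTo (1 / 5 - (-t)) T Literature.Geometry.DiscreteGeometry.fccKissingPattern ∨ Literature.Geometry.DiscreteGeometry.ShellCloseTo (1 / 5 - (-t))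 T Literature.Geometry.DiscreteGeometry.hcpKissingPattern)))) ∧ (∀ i : ℕ, i < n → (z i ≠ z (i + 1) ∧ dist (z i) (z (i + 1)) ≤ a * (1 + 1 / 50) - (-t))))) → (∃ η : ℝ, 0 < η ∧ ∀ ℓ₀ : ℝ, ∃ ℓ : ℝ, ∃ c : EuclideanSpace ℝ (Fin 3), ∃ F : Finset (EuclideanSpace ℝ (Fin 3)), ℓ₀ ≤ ℓ ∧ (↑F : Set (EuclideanSpace ℝ (Fin 3))) = Y ∩ {z | ∀ i : Fin 3, c i ≤ z i ∧ z i < c i + ℓ} ∧ η * ℓ ^ 3 < ∑ y ∈ F, ((∑' w : ↥Y, Literature.MathematicalPhysics.StatisticalMechanics.lennardJones (dist y (w : EuclideanSpace ℝ (Fin 3)))) - 2 * e))) :=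
  Iff.rfl

/-- PIN · the trigger stated ON THE REGISTERED TEXT. -/
theorem stub_sealedChargeLaw_of_wallTension (h : WallTension 25 48) : ∀ e : ℝ, Filter.Tendsto (fun N : ℕ => Literature.MathematicalPhysics.StatisticalMechanics.groundStateEnergy Literature.MathematicalPhysics.StatisticalMechanics.lennardJones 3 N / N) Filter.atTop (nhds e) → (∀ N : ℕ, 0 < N → e ≤ Literature.MathematicalPhysics.StatisticalMechanics.groundStateEnergy Literature.MathematicalPhysics.StatisticalMechanics.lennardJones 3 N / N) → ∀ Y : Set (EuclideanSpace ℝ (Fin 3)), Literature.MathematicalPhysics.StatisticalMechanics.UniformlyDiscrete Y → (∀ z : EuclideanSpace ℝ (Fin 3), ∃ w ∈ Y, dist z w < 9 / 10) → ∀ a : ℝ, 47 / 50 ≤ a → a ≤ 1 → ∀ t : ℝ, 0 < t → (∀ y ∈ Y, ({w ∈ Y | w ≠ y ∧ dist y w ≤ a * (1 + 1 / 50)}.ncard = 12 ∧ ∀ w ∈ Y, w ≠ y → a * (1 - 1 / 50) ≤ dist y w ∧ (dist y w ≤ a * (1 + 1 / 50) ∨ a * (63 / 50) ≤ dist y w))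 → (∃ T : Finset (EuclideanSpace ℝ (Fin 3)), (↑T : Set (EuclideanSpace ℝ (Fin 3))) = (fun w => a⁻¹ • (w - y)) '' {w ∈ Y | w ≠ y ∧ dist y w ≤ a * (1 + 1 / 50)} ∧ (Literature.Geometry.DiscreteGeometry.ShellCloseTo (1 / 5) T Literature.Geometry.DiscreteGeometry.fccKissingPattern ∨ Literature.Geometry.DiscreteGeometry.ShellCloseTo (1 / 5) T Literature.Geometry.DiscreteGeometry.hcpKissingPattern))) → (∀ z : EuclideanSpace ℝ (Fin 3), ∃ y ∈ Y, ({w ∈ Y | w ≠ y ∧ dist y w ≤ a * (1 + 1 / 50)}.ncard = 12 ∧ ∀ w ∈ Y, w ≠ y → a * (1 - 1 / 50) ≤ dist y w ∧ (dist y w ≤ a * (1 + 1 / 50) ∨ a * (63 / 50) ≤ dist y w)) ∧ (∃ T : Finset (EuclideanSpace ℝ (Fin 3)), (↑T : Set (EuclideanSpace ℝ (Fin 3))) = (fun w => a⁻¹ • (w - y)) '' {w ∈ Y | w ≠ y ∧ dist y w ≤ a * (1 + 1 / 50)} ∧ (Literature.Geometry.DiscreteGeometry.ShellCloseTo (1 /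 5) T Literature.Geometry.DiscreteGeometry.fccKissingPattern ∨ Literature.Geometry.DiscreteGeometry.ShellCloseTo (1 / 5) T Literature.Geometry.DiscreteGeometry.hcpKissingPattern)) ∧ dist z y ≤ 10) → (∃ L : ℝ, ∀ p ∈ Y, ∃ y ∈ Y, ∃ y' ∈ Y, dist y p ≤ L ∧ ({w ∈ Y | w ≠ y ∧ dist y w ≤ a * (1 + 1 / 50) - t}.ncard = 12 ∧ (∀ w ∈ Y, w ≠ y → a * (1 - 1 / 50) + t ≤ dist y w ∧ (dist y w ≤ a * (1 + 1 / 50) - t ∨ a * (63 / 50) + t ≤ dist y w)) ∧ (∃ T : Finset (EuclideanSpace ℝ (Fin 3)), (↑T : Set (EuclideanSpace ℝ (Fin 3))) = (fun w => a⁻¹ • (w - y)) '' {w ∈ Y | w ≠ y ∧ dist y w ≤ a * (1 + 1 / 50)} ∧ (Literature.Geometry.DiscreteGeometry.ShellCloseTo (1 / 5 - t) T Literature.Geometry.DiscreteGeometry.fccKissingPattern ∨ Literature.Geometry.DiscreteGeometry.ShellCloseTo (1 / 5 - t) T Literature.Geometry.DiscreteGeometry.hcpKissingPattern))) ∧ ({w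 ∈ Y | w ≠ y' ∧ dist y' w ≤ a * (1 + 1 / 50) - t}.ncard = 12 ∧ (∀ w ∈ Y, w ≠ y' → a * (1 - 1 / 50) + t ≤ dist y' w ∧ (dist y' w ≤ a * (1 + 1 / 50) - t ∨ a * (63 / 50) + t ≤ dist y' w)) ∧ (∃ T : Finset (EuclideanSpace ℝ (Fin 3)), (↑T : Set (EuclideanSpace ℝ (Fin 3))) = (fun w => a⁻¹ • (w - y')) '' {w ∈ Y | w ≠ y' ∧ dist y' w ≤ a * (1 + 1 / 50)} ∧ (Literature.Geometry.DiscreteGeometry.ShellCloseTo (1 / 5 - t) T Literature.Geometry.DiscreteGeometry.fccKissingPattern ∨ Literature.Geometry.DiscreteGeometry.ShellCloseTo (1 / 5 - t) T Literature.Geometry.DiscreteGeometry.hcpKissingPattern))) ∧ dist y y' ≤ 24 + 1 ∧ ¬ (∃ n : ℕ, n ≤ 48 ∧ ∃ z : ℕ → EuclideanSpace ℝ (Fin 3), z 0 = y ∧ z n = y' ∧ (∀ i : ℕ, i ≤ n → z i ∈ Y ∧ ({w ∈ Y | w ≠ (z i) ∧ dist (z i) w ≤ a * (1 + 1 / 50)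 - (-t)}.ncard = 12 ∧ (∀ w ∈ Y, w ≠ (z i) → a * (1 - 1 / 50) + (-t) ≤ dist (z i) w ∧ (dist (z i) w ≤ a * (1 + 1 / 50) - (-t) ∨ a * (63 / 50) + (-t) ≤ dist (z i) w)) ∧ (∃ T : Finset (EuclideanSpace ℝ (Fin 3)), (↑T : Set (EuclideanSpace ℝ (Fin 3))) = (fun w => a⁻¹ • (w - (z i))) '' {w ∈ Y | w ≠ (z i) ∧ dist (z i) w ≤ a * (1 + 1 / 50)} ∧ (Literature.Geometry.DiscreteGeometry.ShellCloseTo (1 / 5 - (-t)) T Literature.Geometry.DiscreteGeometry.fccKissingPattern ∨ Literature.Geometry.DiscreteGeometry.ShellCloseTo (1 / 5 - (-t)) T Literature.Geometry.DiscreteGeometry.hcpKissingPattern)))) ∧ (∀ i : ℕ, i < n → (z i ≠ z (i + 1) ∧ dist (z i) (z (i + 1)) ≤ a * (1 + 1 / 50) - (-t))))) → (∃ η : ℝ, 0 < η ∧ ∀ ℓ₀ : ℝ, ∃ ℓ : ℝ, ∃ c : EuclideanSpace ℝ (Fin 3), ∃ F : Finset (EuclideanSpace ℝ (Fin 3)),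 ℓ₀ ≤ ℓ ∧ (↑F : Set (EuclideanSpace ℝ (Fin 3))) = Y ∩ {z | ∀ i : Fin 3, c i ≤ z i ∧ z i < c i + ℓ} ∧ η * ℓ ^ 3 < ∑ y ∈ F, ((∑' w : ↥Y, Literature.MathematicalPhysics.StatisticalMechanics.lennardJones (dist y (w : EuclideanSpace ℝ (Fin 3)))) - 2 * e)) :=
  sealedChargeLaw_numerals_iff.1 (sealedChargeLaw_numerals_of_wallTension h)

/-- PIN · `WallTension 25 48` fully expanded over Mathlib + Literature declarations only (the text a future registration / citation uses). -/
theorem wallTension_numerals_iff : WallTension 25 48 ↔ (∀ e : ℝ, Filter.Tendsto (fun N : ℕ => Literature.MathematicalPhysics.StatisticalMechanics.groundStateEnergy Literature.MathematicalPhysics.StatisticalMechanics.lennardJones 3 N / N) Filter.atTop (nhds e) → (∀ N : ℕ, 0 < N → e ≤ Literature.MathematicalPhysics.StatisticalMechanics.groundStateEnergy Literature.MathematicalPhysics.StatisticalMechanics.lennardJones 3 N / N) → ∀ δ : ℝ, 0 < δ → ∀ a : ℝ, 47 / 50 ≤ a → a ≤ 1 → ∀ t : ℝ, 0 < t → ∀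 L : ℝ, ∃ κ : ℝ, 0 < κ ∧ ∃ σ : ℝ, 0 ≤ σ ∧ ∀ Y : Set (EuclideanSpace ℝ (Fin 3)), (∀ p ∈ Y, ∀ q ∈ Y, p ≠ q → δ ≤ dist p q) → ∀ c : EuclideanSpace ℝ (Fin 3), ∀ R : ℝ, 1 ≤ R → ∀ K : Set (EuclideanSpace ℝ (Fin 3)), Convex ℝ K → Metric.closedBall c (R / 4) ⊆ K → K ⊆ Metric.closedBall c R → (∀ p ∈ Y ∩ K, ∃ y ∈ Y, ∃ y' ∈ Y, dist y p ≤ L ∧ ({w ∈ Y | w ≠ y ∧ dist y w ≤ a * (1 + 1 / 50) - t}.ncard = 12 ∧ (∀ w ∈ Y, w ≠ y → a * (1 - 1 / 50) + t ≤ dist y w ∧ (dist y w ≤ a * (1 + 1 / 50) - t ∨ a * (63 / 50) + t ≤ dist y w)) ∧ (∃ T : Finset (EuclideanSpace ℝ (Fin 3)), (↑T : Set (EuclideanSpace ℝ (Fin 3))) = (fun w => a⁻¹ • (w - y)) '' {w ∈ Y | w ≠ y ∧ dist y w ≤ a * (1 + 1 / 50)} ∧ (Literature.Geometry.DiscreteGeometry.ShellCloseTo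 (1 / 5 - t) T Literature.Geometry.DiscreteGeometry.fccKissingPattern ∨ Literature.Geometry.DiscreteGeometry.ShellCloseTo (1 / 5 - t) T Literature.Geometry.DiscreteGeometry.hcpKissingPattern))) ∧ ({w ∈ Y | w ≠ y' ∧ dist y' w ≤ a * (1 + 1 / 50) - t}.ncard = 12 ∧ (∀ w ∈ Y, w ≠ y' → a * (1 - 1 / 50) + t ≤ dist y' w ∧ (dist y' w ≤ a * (1 + 1 / 50) - t ∨ a * (63 / 50) + t ≤ dist y' w)) ∧ (∃ T : Finset (EuclideanSpace ℝ (Fin 3)), (↑T : Set (EuclideanSpace ℝ (Fin 3))) = (fun w => a⁻¹ • (w - y')) '' {w ∈ Y | w ≠ y' ∧ dist y' w ≤ a * (1 + 1 / 50)} ∧ (Literature.Geometry.DiscreteGeometry.ShellCloseTo (1 / 5 - t) T Literature.Geometry.DiscreteGeometry.fccKissingPattern ∨ Literature.Geometry.DiscreteGeometry.ShellCloseTo (1 / 5 - t) T Literature.Geometry.DiscreteGeometry.hcpKissingPattern))) ∧ dist y y' ≤ 25 ∧ ¬ (∃ n : ℕ, n ≤ 48 ∧ ∃ z : ℕ → EuclideanSpace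 ℝ (Fin 3), z 0 = y ∧ z n = y' ∧ (∀ i : ℕ, i ≤ n → z i ∈ Y ∧ ({w ∈ Y | w ≠ (z i) ∧ dist (z i) w ≤ a * (1 + 1 / 50) - (-t)}.ncard = 12 ∧ (∀ w ∈ Y, w ≠ (z i) → a * (1 - 1 / 50) + (-t) ≤ dist (z i) w ∧ (dist (z i) w ≤ a * (1 + 1 / 50) - (-t) ∨ a * (63 / 50) + (-t) ≤ dist (z i) w)) ∧ (∃ T : Finset (EuclideanSpace ℝ (Fin 3)), (↑T : Set (EuclideanSpace ℝ (Fin 3))) = (fun w => a⁻¹ • (w - (z i))) '' {w ∈ Y | w ≠ (z i) ∧ dist (z i) w ≤ a * (1 + 1 / 50)} ∧ (Literature.Geometry.DiscreteGeometry.ShellCloseTo (1 / 5 - (-t)) T Literature.Geometry.DiscreteGeometry.fccKissingPattern ∨ Literature.Geometry.DiscreteGeometry.ShellCloseTo (1 / 5 - (-t)) T Literature.Geometry.DiscreteGeometry.hcpKissingPattern)))) ∧ (∀ i : ℕ, i < n → (z i ≠ z (i + 1) ∧ dist (z i) (z (i + 1)) ≤ a * (1 + 1 / 50) - (-t)))))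 → ∀ S : Finset (EuclideanSpace ℝ (Fin 3)), (↑S : Set (EuclideanSpace ℝ (Fin 3))) = Y ∩ K → (e + κ) * (S.card : ℝ) - σ * R ^ 2 ≤ 1 / 2 * ∑ y ∈ S, ∑ w ∈ S, Literature.MathematicalPhysics.StatisticalMechanics.lennardJones (dist y w)) :=
  Iff.rfl

end Summit.AtomisticToContinuum.Crystallization.Theorems.OverbindingBudgetWallTensionLever
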